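import Summits.ResolutionOfSingularities.ResolutionOfSingularities.Theorems.HilbertSamuelEliminationSigmaMaxModificationsCorridor3WLadderStrataBirthsTopDictionary
import Summits.ResolutionOfSingularities.ResolutionOfSingularities.Theorems.HilbertSamuelEliminationSigmaMaxModificationsCorridor3NearStep
import Literature.AlgebraicGeometry.Resolution.BlowupRelativeDimension
import HarnessLib

/-!
# [OURS · L1 W4.2] `Corridor3WLadderStrataDepthBricks` — «STRICT TRANSFORMS KEEP DEPTH» along a chain of canonical near steps:
# the centre-free half of res-type-040's structural binder `StrataDepthDiscipline` (D13), proved for every level `N`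

Crux chain w42 (`SigmaMaxModifications`, stmt-ResolutionOfSingularities-18506; conjunct `SigmaMaxModificationsCorridor3`,
stmt-ResolutionOfSingularities-19249), object D13-DD «DEPTH DISCIPLINE» (res-L1-w42-plan-1 RULINGS v3.13-3 (AM) 2026-08-27T09:09:15Z:
«res-type-053 g10 → D13's structural binder `StrataDepthDiscipline p 3 (QNe Q) (3 ≤ ē)` … start the centre-geometry bricks now in
`…Corridor3WLadderStrataDepthBricks.lean`, instantiate BY NAME when 040's Defs land»; res-type-040's D13 CUT 08:58:02Z). Seat
res-type-053 (gen 10). OURS (cell res-hironaka, slot W4.2); NOT statements of H. Hironaka's manuscript [Hironaka2017] nor of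
[CossartJannsenSaito2020]; AI-proved, weaker than expert review. Sorry-free PROOF file: no definition, no named fact, no binder,
ORACLE-FREE (nothing here quantifies over an oracle class — untouched by kill test k21). `--supports stmt-ResolutionOfSingularities-19249`.

THE SANDWICH LANGUAGE (040's CUT): for a marked stage `s` and `Z ⊆ X_n` through `x_n`, «`Z` has a sandwich at `x_n`» means
`∃ B, IsIrreducible B ∧ IsClosed B ∧ x_n ∈ B ∧ B ⊆ Z ∧ B ≠ {x_n} ∧ B ≠ Z` (040's `HasSandwichAt s Z`, spelled out here so that this
file does not wait for the Defs file; for `x_n` closed and `Z` irreducible closed it says `2 ≤ codim_Z(x_n)`, LIB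
`two_le_coheight_iff_exists_sandwich`). The second conjunct of `StrataDepthDiscipline` reads: along the step projection
`f : X_{n+1} ⟶ X_n`, a component `Z' ∋ x_{n+1}` of `X_{n+1}(ν)` WITH a sandwich whose image closure is a component of `X_n(ν)`
WITHOUT a sandwich at `x_n` has its image closure inside the canonical centre. This file PROVES it — for every `N`, at EVERY step
(not only eventually), and without the hypothesis that the image closure is a stratum component — from the LIB brick
`Literature/AlgebraicGeometry/Resolution/BlowupRelativeDimension.lean` («blowing up does not raise the codimension of a point
inside the strict transform of a closed subvariety not contained in the centre», Matsumura Thm. 15.5 on the charts):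

* §1 `StepProjection.exists_isCanonicalStep_and_isBlowup` — a step projection IS a blow-up of `X_n` in the canonical centre
  (`blowup.isBlowup` transported along the stage identification, as lead-1's `Helpers.isBlowup_chainProj`).
* §2 ONE STEP: `StepProjection.exists_centre_or_coheight_le` — for an irreducible closed `Z' ∋ x_{n+1}`: EITHER its image closure
  lies in the canonical centre, OR `codim_{Z'}(x_{n+1}) ≤ codim_{cl f(Z')}(x_n)`; `StepProjection.exists_centre_of_sandwich` — the
  sandwich form (conjunct 2 of `StrataDepthDiscipline` at one step, `x_n` closed).
* §3 ALONG A CHAIN from a closed point (marked points stay closed, tree `Reaches.isClosed_pt`):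
  `exists_centre_of_sandwich_chain` — conjunct 2 of `StrataDepthDiscipline` for every chain of canonical near steps reached
  from `MarkedStage.init X x` with `x` closed (in particular from a maximal origin, `IsMaximalOrigin.isClosed`), every `n`, every `N`.

What this file does NOT do: conjunct 1 of `StrataDepthDiscipline` («a MOVING newborn component has no sandwich at `x_{n+1}`»),
which is not centre-free: with `B = cl f(Z') ⊊ S` a curve inside the centre component `S ∋ x_n` (040's (S1)) the same chart
inequality WITH the transcendence term (Matsumura 15.5: `dim 𝒪_{Z',x'} ≤ dim 𝒪_{B,x} + tr.deg_{K(B)} K(Z')`, tree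
`Resolution.height_le_height_add_trdeg`) reduces it to «`Z' → B` is generically finite», i.e. to the finiteness of the near points
over the non-closed point `η_B` of the centre (CJS Thm. 3.14 at `η_B` + Thm. 3.6, objects P-b / (AO) of RULINGS v3.13-3) — left to
the by-name discharge once 040's Defs and those facts land.
-/

noncomputable section

set_option linter.dupNamespace false

open CategoryTheory AlgebraicGeometry TopologicalSpace Topology Order
open Summit.ResolutionOfSingularities.ResolutionOfSingularities.Theorems.CampaignW42
open Literature.AlgebraicGeometry.Resolution Literature.RingTheory.HilbertSamuel
open Summit.ResolutionOfSingularities.ResolutionOfSingularities.Theorems.SigmaMaxModificationsCorridor3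

namespace Summit.ResolutionOfSingularities.ResolutionOfSingularities.Theorems.SigmaMaxModificationsCorridor3.Moving

universe u

variable {R : ∀ S : Scheme.{u}, CentreSeq S → Prop} {N : ℕ} {ν : ℕ → ℕ}

/-! ## §1 A step projection is a blow-up in the canonical centre -/

/-- **A step projection `f : X_{n+1} ⟶ X_n` IS a blow-up of `X_n` in a canonical centre `C`** (the chosen blowing up
`Bl_C(X_n) → X_n`, transported along the identification of the stage `X_{n+1}` with `Bl_C(X_n)`; cf. lead-1's
`Helpers.isBlowup_chainProj`). [cite: GortzWedhorn2020, Def. 13.90] -/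
theorem StepProjection.exists_isCanonicalStep_and_isBlowup {s s' : MarkedStage.{u}} {f : s'.W ⟶ s.W}
    (hf : StepProjection R N ν s s' f) :
    ∃ (C : s.W.IdealSheafData) (P' : Option (Pending (blowup C))), IsCanonicalStep R N ν s.L s.P C P' ∧ IsBlowup f C := by
  obtain ⟨C, P', h, x', hcs, -, -, -, e, hfe⟩ := hf
  refine ⟨C, P', hcs, ?_⟩
  rw [hfe]
  exact (blowup.isBlowup C).iso_comp (eqToIso (congrArg MarkedStage.W e))

/-- The marked point of the target of a step projection is closed. [folklore] -/
theorem StepProjection.isClosed_pt {s s' : MarkedStage.{u}} {f : s'.W ⟶ s.W} (hf : StepProjection R N ν s s' f) :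
    IsClosed ({s'.pt} : Set s'.W) :=
  hf.canonicalNearStep.isClosed_pt

/-! ## §2 One step: strict transforms keep depth -/

/-- **EITHER OVER THE CENTRE, OR NO DEEPER.** Along a step projection `f : X_{n+1} ⟶ X_n` (a blow-up of the locally Noetherian
stage `X_n` in the canonical centre `C`), for every irreducible closed `Z' ⊆ X_{n+1}` through `x_{n+1}`: either `cl f(Z') ⊆ V(C)`,
or `codim_{Z'}(x_{n+1}) ≤ codim_{cl f(Z')}(x_n)` (`dim 𝒪_{Z',x_{n+1}} ≤ dim 𝒪_{cl f(Z'),x_n}`: blowing up does not raise the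
codimension of a point inside a strict transform, LIB `IsBlowup.coheight_le_coheight_closure_image`).
[cite: Matsumura1987, Thm. 15.5] -/
theorem StepProjection.exists_centre_or_coheight_le {s s' : MarkedStage.{u}} {f : s'.W ⟶ s.W}
    (hf : StepProjection R N ν s s' f) {Z' : Set s'.W} (hirr : IsIrreducible Z') (hcl : IsClosed Z') (hx' : s'.pt ∈ Z') :
    (∃ (C : s.W.IdealSheafData) (P' : Option (Pending (blowup C))), IsCanonicalStep R N ν s.L s.P C P' ∧
        closure (f.base '' Z') ⊆ (C.support : Set s.W)) ∨
      coheight (⟨s'.pt, hx'⟩ : ↥Z') ≤ coheight (⟨s.pt, subset_closure ⟨s'.pt, hx', hf.base_pt⟩⟩ : ↥(closure (f.base '' Z'))) := by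
  haveI := s.ln
  obtain ⟨C, P', hcs, hbl⟩ := hf.exists_isCanonicalStep_and_isBlowup
  by_cases hB : closure (f.base '' Z') ⊆ (C.support : Set s.W)
  · exact Or.inl ⟨C, P', hcs, hB⟩
  · refine Or.inr ?_
    have key := hbl.coheight_le_coheight_closure_image hirr hcl hx' hB
    have hpt : f.base s'.pt = s.pt := hf.base_pt
    -- same point of `cl f(Z')`, two membership proofs
    have e : (⟨f.base s'.pt, subset_closure ⟨s'.pt, hx', rfl⟩⟩ : ↥(closure (f.base '' Z'))) =
        ⟨s.pt, subset_closure ⟨s'.pt, hx', hf.base_pt⟩⟩ := Subtype.ext hpt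
    rw [e] at key
    exact key

/-- **CONJUNCT 2 OF `StrataDepthDiscipline` AT ONE STEP (sandwich form).** Along a step projection `f : X_{n+1} ⟶ X_n` with
`x_n` closed: if an irreducible closed `Z' ∋ x_{n+1}` has a sandwich at `x_{n+1}` (an irreducible closed `B'` with
`x_{n+1} ∈ B' ⊆ Z'`, `B' ≠ {x_{n+1}}`, `B' ≠ Z'`) while its image closure `B = cl f(Z')` has NO sandwich at `x_n`, then `B` lies
in the canonical centre: `∃ C P', IsCanonicalStep R N ν L_n P_n C P' ∧ B ⊆ V(C)`. (A sandwich at a closed point of an irreducible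
closed set is `2 ≤ codim`, LIB `two_le_coheight_iff_exists_sandwich`; then `exists_centre_or_coheight_le`.)
[cite: Matsumura1987, Thm. 15.5] -/
theorem StepProjection.exists_centre_of_sandwich {s s' : MarkedStage.{u}} {f : s'.W ⟶ s.W}
    (hf : StepProjection R N ν s s' f) (hsc : IsClosed ({s.pt} : Set s.W)) {Z' : Set s'.W} (hirr : IsIrreducible Z')
    (hcl : IsClosed Z') (hx' : s'.pt ∈ Z')
    (hup : ∃ B' : Set s'.W, IsIrreducible B' ∧ IsClosed B' ∧ s'.pt ∈ B' ∧ B' ⊆ Z' ∧ B' ≠ {s'.pt} ∧ B' ≠ Z')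
    (hdown : ¬ ∃ B : Set s.W, IsIrreducible B ∧ IsClosed B ∧ s.pt ∈ B ∧ B ⊆ closure (f.base '' Z') ∧
      B ≠ {s.pt} ∧ B ≠ closure (f.base '' Z')) :
    ∃ (C : s.W.IdealSheafData) (P' : Option (Pending (blowup C))), IsCanonicalStep R N ν s.L s.P C P' ∧
      closure (f.base '' Z') ⊆ (C.support : Set s.W) := by
  rcases hf.exists_centre_or_coheight_le hirr hcl hx' with h | hle
  · exact h
  · exfalso
    have hirrB : IsIrreducible (closure (f.base '' Z')) := (hirr.image f.base f.continuous.continuousOn).closure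
    have h2 : 2 ≤ coheight (⟨s'.pt, hx'⟩ : ↥Z') :=
      (two_le_coheight_iff_exists_sandwich hirr hcl hx' hf.isClosed_pt).mpr hup
    exact hdown ((two_le_coheight_iff_exists_sandwich hirrB isClosed_closure
      (subset_closure ⟨s'.pt, hx', hf.base_pt⟩) hsc).mp (h2.trans hle))

/-- The same for a component of the stratum through the marked point (`Z' ∈ componentsThrough N ν s'`), the shape in which
`StrataDepthDiscipline` quantifies. [cite: Matsumura1987, Thm. 15.5] -/
theorem StepProjection.exists_centre_of_sandwich_of_mem_componentsThrough {s s' : MarkedStage.{u}} {f : s'.W ⟶ s.W}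
    (hf : StepProjection R N ν s s' f) (hsc : IsClosed ({s.pt} : Set s.W)) (hY' : IsClosed (Scheme.hsStratum s'.W N ν))
    {Z' : Set s'.W} (hZ' : Z' ∈ componentsThrough N ν s')
    (hup : ∃ B' : Set s'.W, IsIrreducible B' ∧ IsClosed B' ∧ s'.pt ∈ B' ∧ B' ⊆ Z' ∧ B' ≠ {s'.pt} ∧ B' ≠ Z')
    (hdown : ¬ ∃ B : Set s.W, IsIrreducible B ∧ IsClosed B ∧ s.pt ∈ B ∧ B ⊆ closure (f.base '' Z') ∧
      B ≠ {s.pt} ∧ B ≠ closure (f.base '' Z')) :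
    ∃ (C : s.W.IdealSheafData) (P' : Option (Pending (blowup C))), IsCanonicalStep R N ν s.L s.P C P' ∧
      closure (f.base '' Z') ⊆ (C.support : Set s.W) :=
  hf.exists_centre_of_sandwich hsc (componentsIn.isIrreducible hZ'.1) (componentsIn.isClosed hY' hZ'.1) hZ'.2 hup hdown

/-! ## §3 Along a chain from a closed point -/

/-- **CONJUNCT 2 OF `StrataDepthDiscipline` ALONG A CHAIN, EVERY STEP, EVERY LEVEL.** For a chain `c` of canonical near steps
reached from `MarkedStage.init X x` with `x` closed (e.g. a maximal origin), every `n`, every step projection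
`f : X_{n+1} ⟶ X_n` of the `n`-th step and every irreducible closed `Z' ∋ x_{n+1}` (e.g. a member of
`componentsThrough N ν (c (n+1))` on a stage with closed stratum): a sandwich at `x_{n+1}` in `Z'` and none at `x_n` in
`cl f(Z')` force `cl f(Z')` into the canonical centre of the step. [cite: Matsumura1987, Thm. 15.5] -/
theorem exists_centre_of_sandwich_chain {X : Scheme.{u}} [IsLocallyNoetherian X] {x : X} (hx : IsClosed ({x} : Set X))
    {c : ℕ → MarkedStage.{u}} (h0 : Reaches R N ν (MarkedStage.init X x) (c 0))
    (hstep : ∀ n, CanonicalNearStep R N ν (c n) (c (n + 1))) (n : ℕ) {f : (c (n + 1)).W ⟶ (c n).W}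
    (hf : StepProjection R N ν (c n) (c (n + 1)) f) {Z' : Set (c (n + 1)).W} (hirr : IsIrreducible Z') (hcl : IsClosed Z')
    (hx' : (c (n + 1)).pt ∈ Z')
    (hup : ∃ B' : Set (c (n + 1)).W, IsIrreducible B' ∧ IsClosed B' ∧ (c (n + 1)).pt ∈ B' ∧ B' ⊆ Z' ∧
      B' ≠ {(c (n + 1)).pt} ∧ B' ≠ Z')
    (hdown : ¬ ∃ B : Set (c n).W, IsIrreducible B ∧ IsClosed B ∧ (c n).pt ∈ B ∧ B ⊆ closure (f.base '' Z') ∧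
      B ≠ {(c n).pt} ∧ B ≠ closure (f.base '' Z')) :
    ∃ (C : (c n).W.IdealSheafData) (P' : Option (Pending (blowup C))), IsCanonicalStep R N ν (c n).L (c n).P C P' ∧
      closure (f.base '' Z') ⊆ (C.support : Set (c n).W) :=
  hf.exists_centre_of_sandwich (Reaches.isClosed_pt hx (reaches_chain h0 hstep n)) hirr hcl hx' hup hdown

/-- From a MAXIMAL ORIGIN (the rows' setting): the same, with `x` closed by `IsMaximalOrigin.isClosed`.
[cite: Matsumura1987, Thm. 15.5] -/
theorem exists_centre_of_sandwich_chain_of_isMaximalOrigin {p : ℕ} {X : Scheme.{u}} [IsLocallyNoetherian X] {x : X}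
    (hX : IsMaximalOrigin p N ν X x) {c : ℕ → MarkedStage.{u}} (h0 : Reaches R N ν (MarkedStage.init X x) (c 0))
    (hstep : ∀ n, CanonicalNearStep R N ν (c n) (c (n + 1))) (n : ℕ) {f : (c (n + 1)).W ⟶ (c n).W}
    (hf : StepProjection R N ν (c n) (c (n + 1)) f) {Z' : Set (c (n + 1)).W} (hirr : IsIrreducible Z') (hcl : IsClosed Z')
    (hx' : (c (n + 1)).pt ∈ Z')
    (hup : ∃ B' : Set (c (n + 1)).W, IsIrreducible B' ∧ IsClosed B' ∧ (c (n + 1)).pt ∈ B' ∧ B' ⊆ Z' ∧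
      B' ≠ {(c (n + 1)).pt} ∧ B' ≠ Z')
    (hdown : ¬ ∃ B : Set (c n).W, IsIrreducible B ∧ IsClosed B ∧ (c n).pt ∈ B ∧ B ⊆ closure (f.base '' Z') ∧
      B ≠ {(c n).pt} ∧ B ≠ closure (f.base '' Z')) :
    ∃ (C : (c n).W.IdealSheafData) (P' : Option (Pending (blowup C))), IsCanonicalStep R N ν (c n).L (c n).P C P' ∧
      closure (f.base '' Z') ⊆ (C.support : Set (c n).W) :=
  exists_centre_of_sandwich_chain hX.isClosed h0 hstep n hf hirr hcl hx' hup hdown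

end Summit.ResolutionOfSingularities.ResolutionOfSingularities.Theorems.SigmaMaxModificationsCorridor3.Moving

end
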